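import Summits.AtomisticToContinuum.Crystallization.Theses.IsometryAtoms
import Literature.Probability.Process.RootedHardCoreVague

/-!
# Negative knowledge for crux `MinimisingLawsHaveAtoms` (stmt-AtomisticToContinuum-15776), VIII:
# the dilation family on the space of rooted hard-core configurations

Standing crux disprover `cdisprove-stmt-AtomisticToContinuum-15776`,
`--supports stmt-AtomisticToContinuum-15776`; third piece of the threshold-sharpness programme
(random dilation of the abstract minimising law).  Everything definition-free; the dilation factor
is clamped to `max c 1` so that the family is total on `ℝ`.

* `smul_image_rooted_separated` — dilating a rooted `δ`-separated set by `c ≥ 1` keeps it rooted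
  and `δ`-separated (the `RootedHardCoreConfig` proof obligation of the dilate);
* `locallyMatches_smul_image` — matched configurations have matched dilates, quantitatively
  (`dist (a•s) (b•t) ≤ a·dist s t + |a − b|·‖t‖`);
* `continuous_dilate` — **the dilation `(c, S) ↦ (max c 1) • S` is JOINTLY CONTINUOUS** on
  `ℝ × RootedHardCoreConfig ℝ³ δ` in the local rubber metric (hence Borel measurable, so that laws
  can be pushed through it and Tonelli applies);
* `map_smul_count_restrict` — on counting measures the dilation is the push-forward
  `(c • ·)_* count|S = count|(c • S)` (`c ≠ 0`).
All `[folklore]`.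
-/

noncomputable section

namespace Summit.AtomisticToContinuum.Crystallization.Theorems.MinimisingLawsHaveAtoms.Negative.DilationFamily

open MeasureTheory Set Filter Metric Function
open scoped ENNReal Topology
open Literature.MathematicalPhysics.StatisticalMechanics Literature.Probability.Process
open Literature.Probability.Process.LocalConfig

/-! ## §1 Dilates of rooted separated sets -/

/-- Dilating by `c ≥ 1` keeps a rooted `δ`-separated set rooted and `δ`-separated (the proof
obligation of `RootedHardCoreConfig` for the dilate). [folklore] -/
theorem smul_image_rooted_separated {δ c : ℝ} (hc : 1 ≤ c) {S : Set (EuclideanSpace ℝ (Fin 3))}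
    (h0 : (0 : EuclideanSpace ℝ (Fin 3)) ∈ S)
    (hsep : ∀ x ∈ S, ∀ y ∈ S, x ≠ y → δ ≤ dist x y) :
    (0 : EuclideanSpace ℝ (Fin 3)) ∈ (LocalConfig.mk ((fun x : EuclideanSpace ℝ (Fin 3) => c • x) '' S) :
        LocalConfig (EuclideanSpace ℝ (Fin 3))) ∧
      ∀ x ∈ (LocalConfig.mk ((fun x : EuclideanSpace ℝ (Fin 3) => c • x) '' S) :
        LocalConfig (EuclideanSpace ℝ (Fin 3))),
      ∀ y ∈ (LocalConfig.mk ((fun x : EuclideanSpace ℝ (Fin 3) => c • x) '' S) :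
        LocalConfig (EuclideanSpace ℝ (Fin 3))), x ≠ y → δ ≤ dist x y := by
  refine ⟨⟨0, h0, smul_zero c⟩, ?_⟩
  rintro _ ⟨x, hx, rfl⟩ _ ⟨y, hy, rfl⟩ hne
  have hxy : x ≠ y := fun e => hne (by rw [e])
  rw [dist_smul₀, Real.norm_of_nonneg (by positivity)]
  calc δ ≤ dist x y := hsep x hx y hy hxy
    _ = 1 * dist x y := (one_mul _).symm
    _ ≤ c * dist x y := mul_le_mul_of_nonneg_right hc dist_nonneg

/-- The dilation acts on counting measures as a push-forward: `(c • ·)_* count|S = count|(c • S)`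
(`c ≠ 0`). [folklore] -/
theorem map_smul_count_restrict {c : ℝ} (hc : c ≠ 0) (S : Set (EuclideanSpace ℝ (Fin 3))) :
    ((Measure.count : Measure (EuclideanSpace ℝ (Fin 3))).restrict S).map
        (fun x : EuclideanSpace ℝ (Fin 3) => c • x) =
      (Measure.count : Measure (EuclideanSpace ℝ (Fin 3))).restrict
        ((fun x : EuclideanSpace ℝ (Fin 3) => c • x) '' S) := by
  have hinj : Injective fun x : EuclideanSpace ℝ (Fin 3) => c • x := smul_right_injective _ hc
  ext s hs
  rw [Measure.map_apply (measurable_const_smul c) hs, Measure.restrict_apply hs,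
    Measure.restrict_apply ((measurable_const_smul c) hs),
    ← Set.image_preimage_inter (fun x => c • x) S s, Measure.count_injective_image hinj]

/-! ## §2 Matched configurations have matched dilates -/

/-- The basic estimate `dist (a • s) (b • t) ≤ a·dist s t + |a − b|·‖t‖` (`a ≥ 0`). [folklore] -/
theorem dist_smul_smul_le {a b : ℝ} (ha : 0 ≤ a) (s t : EuclideanSpace ℝ (Fin 3)) :
    dist (a • s) (b • t) ≤ a * dist s t + |a - b| * ‖t‖ := by
  calc dist (a • s) (b • t) ≤ dist (a • s) (a • t) + dist (a • t) (b • t) := dist_triangle _ _ _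
    _ = a * dist s t + |a - b| * ‖t‖ := by
        congr 1
        · rw [dist_smul₀, Real.norm_of_nonneg ha]
        · rw [dist_eq_norm, ← sub_smul, norm_smul, Real.norm_eq_abs]

/-- **Matched configurations have matched dilates**: if `S₀, T` are `(R, ε')`-matched and
`a, b ≥ 1` then `a • S₀`, `b • T` are `(R, a ε' + |a − b| (|R| + ε'))`-matched. [folklore] -/
theorem locallyMatches_smul_image {R ε' a b : ℝ} (ha : 1 ≤ a) (hb : 1 ≤ b) (hε' : 0 ≤ ε')
    {S₀ T : Set (EuclideanSpace ℝ (Fin 3))} (h : LocallyMatches R ε' S₀ T) :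
    LocallyMatches R (a * ε' + |a - b| * (|R| + ε'))
      ((fun x : EuclideanSpace ℝ (Fin 3) => a • x) '' S₀)
      ((fun x : EuclideanSpace ℝ (Fin 3) => b • x) '' T) := by
  have ha0 : 0 ≤ a := zero_le_one.trans ha
  have hb0 : 0 < b := one_pos.trans_le hb
  refine ⟨?_, ?_⟩
  · rintro _ ⟨t, ht, rfl⟩ hpR
    have htR : ‖t‖ ≤ R := by
      rw [norm_smul, Real.norm_of_nonneg hb0.le] at hpR
      nlinarith [norm_nonneg t]
    obtain ⟨s, hs, hst⟩ := h.1 t ht htR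
    refine ⟨a • s, ⟨s, hs, rfl⟩, (dist_smul_smul_le ha0 s t).trans ?_⟩
    have h1 : a * dist s t ≤ a * ε' := mul_le_mul_of_nonneg_left hst ha0
    have h2 : |a - b| * ‖t‖ ≤ |a - b| * (|R| + ε') :=
      mul_le_mul_of_nonneg_left (htR.trans ((le_abs_self R).trans (by linarith))) (abs_nonneg _)
    linarith
  · rintro _ ⟨s, hs, rfl⟩ hqR
    have hsR : ‖s‖ ≤ R := by
      rw [norm_smul, Real.norm_of_nonneg ha0] at hqR
      nlinarith [norm_nonneg s]
    obtain ⟨t, ht, hst⟩ := h.2 s hs hsR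
    refine ⟨b • t, ⟨t, ht, rfl⟩, (dist_smul_smul_le ha0 s t).trans ?_⟩
    have htn : ‖t‖ ≤ |R| + ε' := by
      have := norm_le_norm_add_norm_sub' t s
      rw [← dist_eq_norm, dist_comm] at this
      linarith [le_abs_self R]
    have h1 : a * dist s t ≤ a * ε' := mul_le_mul_of_nonneg_left hst ha0
    have h2 : |a - b| * ‖t‖ ≤ |a - b| * (|R| + ε') := mul_le_mul_of_nonneg_left htn (abs_nonneg _)
    linarith

/-! ## §3 Joint continuity of the dilation -/

/-- **The clamped dilation `(c, S) ↦ (max c 1) • S` is jointly continuous** on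
`ℝ × LocalConfig ℝ³` in the local rubber metric. [folklore] -/
theorem continuous_dilate_localConfig :
    Continuous fun p : ℝ × LocalConfig (EuclideanSpace ℝ (Fin 3)) =>
      (LocalConfig.mk ((fun x : EuclideanSpace ℝ (Fin 3) => max p.1 1 • x) '' (p.2 : Set _)) :
        LocalConfig (EuclideanSpace ℝ (Fin 3))) := by
  refine continuous_iff_continuousAt.2 fun p₀ => ?_
  obtain ⟨c₀, S₀⟩ := p₀
  rw [ContinuousAt, tendsto_iff_locallyMatches]
  intro R ε hε
  set a : ℝ := max c₀ 1 with hadef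
  have ha : 1 ≤ a := le_max_right _ _
  have ha0 : 0 < a := one_pos.trans_le ha
  set ε' : ℝ := ε / (2 * a) with hε'def
  have hε' : 0 < ε' := by positivity
  set η : ℝ := ε / (2 * (|R| + ε' + 1)) with hηdef
  have hη : 0 < η := by positivity
  have hS := (nhds_hasBasis_locallyMatches S₀).mem_of_mem (i := (R, ε')) hε'
  filter_upwards [prod_mem_nhds (Metric.ball_mem_nhds c₀ hη) hS] with p hp
  obtain ⟨hc, hT⟩ := hp
  simp only [mem_setOf_eq] at hT
  rw [Metric.mem_ball, Real.dist_eq] at hc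
  set b : ℝ := max p.1 1 with hbdef
  have hb : 1 ≤ b := le_max_right _ _
  have hab : |a - b| ≤ η := by
    rw [abs_sub_comm]
    exact (abs_max_sub_max_le_abs _ _ _).trans hc.le
  have hm := locallyMatches_smul_image (R := R) ha hb hε'.le hT
  refine hm.mono le_rfl ?_
  -- `a ε' + |a − b| (|R| + ε') ≤ ε`
  have h1 : a * ε' = ε / 2 := by rw [hε'def]; field_simp
  have h2 : |a - b| * (|R| + ε') ≤ η * (|R| + ε') :=
    mul_le_mul_of_nonneg_right hab (by positivity)
  have h3 : η * (|R| + ε') ≤ ε / 2 := by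
    rw [hηdef, div_mul_eq_mul_div, div_le_div_iff₀ (by positivity) (by positivity)]
    nlinarith [abs_nonneg R, hε'.le, hε.le]
  linarith

/-- **The clamped dilation is jointly continuous on rooted hard-core configurations**
`ℝ × RootedHardCoreConfig ℝ³ δ → RootedHardCoreConfig ℝ³ δ`. [folklore] -/
theorem continuous_dilate {δ : ℝ} :
    Continuous fun p : ℝ × RootedHardCoreConfig (EuclideanSpace ℝ (Fin 3)) δ =>
      (⟨LocalConfig.mk ((fun x : EuclideanSpace ℝ (Fin 3) => max p.1 1 • x) ''
          ((p.2.1 : LocalConfig (EuclideanSpace ℝ (Fin 3))) : Set (EuclideanSpace ℝ (Fin 3)))),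
        smul_image_rooted_separated (le_max_right _ _) p.2.2.1 p.2.2.2⟩ :
          RootedHardCoreConfig (EuclideanSpace ℝ (Fin 3)) δ) :=
  (continuous_dilate_localConfig.comp
    (continuous_fst.prodMk (continuous_subtype_val.comp continuous_snd))).subtype_mk _

/-- The clamped dilation is jointly Borel measurable. [folklore] -/
theorem measurable_dilate {δ : ℝ} [Fact (0 < δ)] :
    Measurable fun p : ℝ × RootedHardCoreConfig (EuclideanSpace ℝ (Fin 3)) δ =>
      (⟨LocalConfig.mk ((fun x : EuclideanSpace ℝ (Fin 3) => max p.1 1 • x) ''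
          ((p.2.1 : LocalConfig (EuclideanSpace ℝ (Fin 3))) : Set (EuclideanSpace ℝ (Fin 3)))),
        smul_image_rooted_separated (le_max_right _ _) p.2.2.1 p.2.2.2⟩ :
          RootedHardCoreConfig (EuclideanSpace ℝ (Fin 3)) δ) :=
  continuous_dilate.measurable

/-- The counting measure of the dilate is the push-forward of the counting measure. [folklore] -/
theorem toMeasure_dilate {δ : ℝ} (c : ℝ) (S : RootedHardCoreConfig (EuclideanSpace ℝ (Fin 3)) δ) :
    (LocalConfig.mk ((fun x : EuclideanSpace ℝ (Fin 3) => max c 1 • x) ''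
        ((S.1 : LocalConfig (EuclideanSpace ℝ (Fin 3))) : Set (EuclideanSpace ℝ (Fin 3)))) :
          LocalConfig (EuclideanSpace ℝ (Fin 3))).toMeasure =
      ((S.1 : LocalConfig (EuclideanSpace ℝ (Fin 3))).toMeasure).map
        fun x : EuclideanSpace ℝ (Fin 3) => max c 1 • x := by
  rw [toMeasure_def, toMeasure_def, coe_mk, map_smul_count_restrict]
  positivity

end Summit.AtomisticToContinuum.Crystallization.Theorems.MinimisingLawsHaveAtoms.Negative.DilationFamily

end
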